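import Literature.NumberTheory.EllipticCurves.FormalGroupLubinTateDivisionPointsOrdinaryRoot
import Literature.NumberTheory.GaloisRepresentations.LubinTateHomPoints
import Literature.NumberTheory.GaloisRepresentations.CyclotomicCharacterArtinNormProofs
import HarnessLib

/-!
# de Shalit II.4.4 (iv) ⇒ (12) assembled: a `[π]_Ê`-COHERENT sequence of torsion points `U_n ∈ E₁(E·K_π^{n+1})` of exact order `p^{n+1}`
# IS `P([a]_f ω_{n+1})` for ONE unit `a ∈ 𝒪_Fˣ` (the Tate-module unit of the cell's bridge — proofs only)

Topic `NumberTheory/EllipticCurves` (theorems only; no definition, no named fact, no instance).  Cell `bsd-print-cf2`, width seat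
`bsd-line-cf2c-w4` g15; brick B10a of the memo `ALPHA-ASSEMBLY-w4g15.md` (the (TG)-feeding step of the (e)-assembler's recipe for the chart
identity (he) of `relColemanSeries_eq_subst_subst_of_forall_sub_ptOfZ_eq`).  De Shalit II §4.4: «(iv) a choice of `u_n ∈ L/𝔭ⁿL`, primitive of
level `𝔭ⁿ`, such that `u_n ≡ u_{n−1} mod 𝔭^{n−1}L`» ⟺ «(iii) a choice of `(ω_n)`» ⟺ a generator of the Tate module; (12) `ω_n = t(ξ(Λ(𝔭⁻ⁿ)u_n))`.
In the lane's layer (place of degree one `e : 𝒪[F] ≃+* ℤ_p`, ordinary `V/ℤ_p` with `V̂ = F_P`, `P ∈ 𝔉_{π_ℤ}`, `e π = π_ℤ`, `p = ϖπ_ℤ`; the lane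
curve `V ⊗ LTCoeff F` over the fields `M_n = E·K_π^{n+1}`; `h = [1]_{P′,f} : F_{πX+X^q} ≃ V̂`):

* ★★★ `exists_unit_forall_ptOfZ_hom_hom_cohPt_eq` — **given points `U_n ∈ E₁(M_n)` of order exactly `p^{n+1}` with
  `[π]_{P′}(z(U_{n+1})) = z(U_n)` (read in `M_{n+1}`), there is a unit `a ∈ 𝒪_Fˣ` with `P(h([a]_f ω_{n+1})) = U_n` for every `n`** —
  composition BY NAME of (OR) `aeval_ltPolyDiv_coe_hom_one_zPt_eq_zero_of_addOrderOf` (order `p^{n+1}` ⇒ `μ_n := [1]_{f,P′} z(U_n)` is a root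
  of `φ_{n+1}`), the intertwining `[π]_f ∘ [1]_{f,P′} = [1]_{f,P′} ∘ [π]_{P′}` (`ltSMul_evalPt₁_hom_one`) and naturality along the tower
  (`algHom_evalPt₁_hom`, `inclUnitBall_ltSMul`) ⇒ `f(μ_{n+1}) = μ_n` (`aeval_ltPoly_coe_eq_of_ltSMul_eq`), (TG)
  `exists_unit_forall_coe_ltAct_cohPt_eq` ⇒ `a`, and `[1]_{P′,f} ∘ [1]_{f,P′} = id` (`evalPt₁_hom_one_evalPt₁_hom_one`), `P(z(U)) = U`
  (`eq_ptOfZ_zPt`).  The parameter `h([a]_f ω_{n+1})` is literally the `t_n` of the bridge reduction (with `H₁ = h`, `H₂ = [a]_f`).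

What is NOT here: the construction of de Shalit's points `U_n = φ⁻ⁿξ(Ω) − ξ(Ω/ψ(𝔭)ⁿ)` and their three properties (E₁-membership, order,
`[π]`-coherence — bricks B1/B4/B8/B9 and `CMFormalActionNilIdealPointsChart`).  No summit statement is proved; BSD is not proved by any of this.

## References
* [deShalit1987] E. de Shalit, *Iwasawa theory of elliptic curves with complex multiplication* (1987), II §4.4 (11)–(12), (iii)–(iv), II §4.9 (ii).
* [CasselsFrohlichANT1967] J.-P. Serre, *Local class field theory* (Cassels–Fröhlich Ch. VI), §3.5 Prop. 1, §3.6 Prop. 6.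
* [SilvermanAEC2009] J. H. Silverman, *The Arithmetic of Elliptic Curves*, 2nd ed. (2009), VII.2.2.
-/

noncomputable section

open scoped Classical
open PowerSeries

namespace Literature.NumberTheory.EllipticCurves

open ValuativeRel Literature.NumberTheory.GaloisRepresentations
  Literature.NumberTheory.GaloisRepresentations.IsNonarchimedeanLocalField
  Literature.NumberTheory.GaloisRepresentations.LubinTate
open Literature.NumberTheory.EllipticCurves.FormalGroupChart _root_.WeierstrassCurve

section TateUnit

variable {F : Type} [Field F] [ValuativeRel F] [TopologicalSpace F] [IsNonarchimedeanLocalField F]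

attribute [local instance] ltNormUniformSpace ltNormIsUniformAddGroup rk1 nF nE fintypeResidueField

variable {p : ℕ} [Fact p.Prime] (e : 𝒪[F] ≃+* ℤ_[p]) (hq : residueFieldCard F = p)
  {π : 𝒪[F]} (hπ : (valuation F).IsUniformizer (π : F)) {πZ : ℤ_[p]} (he : e π = πZ)
  (hA : IsLTRing πZ p) {P : PowerSeries ℤ_[p]} (hP : IsLTSeries πZ p P)
  {V : WeierstrassCurve ℤ_[p]} (hV : V.formalGroupLaw = ltF hA hP) {ϖ : ℤ_[p]} (hp : (p : ℤ_[p]) = ϖ * πZ) (hϖ : IsUnit ϖ)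
  (E : IntermediateField F (AlgebraicClosure F)) [FiniteDimensional F E]

include hV hp hϖ in
set_option maxHeartbeats 800000 in
/-- ★★★ **de Shalit II.4.4 (iv) ⇒ (12), assembled: coherent torsion points of `E₁` of exact order `p^{n+1}` are `P(h([a]_f ω_{n+1}))` for ONE
unit `a`.**  For points `U_n ∈ E₁(M_n)` (`M_n = E·K_π^{n+1}`) of the lane curve `V ⊗ LTCoeff F` with `addOrderOf U_n = p^{n+1}` and
`[π]_{P′}(z(U_{n+1})) = ι(z(U_n))` (`ι : 𝔪_{M_n} → 𝔪_{M_{n+1}}`), there is `a ∈ 𝒪_Fˣ` with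
`P(h([a]_f(ι ω_{n+1}))) = U_n` for all `n` (`h = [1]_{P′,f}`, `ω_{n+1} = cohPt hπ n`).  See the module docstring for the proof by name.
[cite: deShalit1987, II §4.4 (11)–(12), (iii)–(iv)] [cite: CasselsFrohlichANT1967, Ch. VI §3.5 Prop. 1, §3.6 Prop. 6] -/
theorem exists_unit_forall_ptOfZ_hom_hom_cohPt_eq
    [hEll : ∀ n : ℕ, (curveOver (E ⊔ ltField π n : IntermediateField F (AlgebraicClosure F))
      (V.map ((LTCoeff.of F).toRingHom.comp e.symm.toRingHom))).IsElliptic]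
    (U : ∀ n : ℕ, (curveOver (E ⊔ ltField π n : IntermediateField F (AlgebraicClosure F))
      (V.map ((LTCoeff.of F).toRingHom.comp e.symm.toRingHom))).toAffine.Point)
    (hU : ∀ n : ℕ, U n ∈ kernel (NormedField.valuation (K := (E ⊔ ltField π n : IntermediateField F (AlgebraicClosure F))))
      (curveOver (E ⊔ ltField π n : IntermediateField F (AlgebraicClosure F)) (V.map ((LTCoeff.of F).toRingHom.comp e.symm.toRingHom))))
    (hord : ∀ n : ℕ, addOrderOf (U n) = p ^ (n + 1))
    (hcoh : ∀ n : ℕ, ltSMul (maxNilIdeal F (E ⊔ ltField π (n + 1) : IntermediateField F (AlgebraicClosure F))) (isLTRing_LTCoeff hπ)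
        (isLTSeries_map_LTCoeff_of_degree_one e hq he hP) (LTCoeff.of F π) (zPt (U (n + 1)) (hU (n + 1))) =
      inclPt (sup_le_sup_left (ltField_mono hπ (Nat.le_succ n)) E) (zPt (U n) (hU n))) :
    ∃ a : 𝒪[F]ˣ, ∀ n : ℕ,
      ptOfZ (E ⊔ ltField π n : IntermediateField F (AlgebraicClosure F)) (V.map ((LTCoeff.of F).toRingHom.comp e.symm.toRingHom))
        (evalPt₁ (maxNilIdeal F (E ⊔ ltField π n : IntermediateField F (AlgebraicClosure F)))
          (hom (isLTRing_LTCoeff hπ) (isLTSeries_map_LTCoeff_of_degree_one e hq he hP) (isLTSeries_LTCoeff π) 1)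
          (constantCoeff_hom _ _ _ 1)
          (evalPt₁ (maxNilIdeal F (E ⊔ ltField π n : IntermediateField F (AlgebraicClosure F)))
            (hom (isLTRing_LTCoeff hπ) (isLTSeries_LTCoeff π) (isLTSeries_LTCoeff π) (LTCoeff.of F (a : 𝒪[F])))
            (constantCoeff_hom _ _ _ _)
            (inclPt (le_sup_right : ltField π n ≤ E ⊔ ltField π n) (cohPt hπ n)))) = U n := by
  -- notation: `hP′ : P′ ∈ 𝔉_π` over `LTCoeff F`; `μpt n = [1]_{f,P′} z(U_n) ∈ 𝔪_{M_n}`, `μ n` its image in `F̄`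
  have hP' := isLTSeries_map_LTCoeff_of_degree_one e hq he hP
  let μpt : ∀ n : ℕ, (maxNilIdeal F (E ⊔ ltField π n : IntermediateField F (AlgebraicClosure F))).toIdeal := fun n =>
    evalPt₁ (maxNilIdeal F (E ⊔ ltField π n : IntermediateField F (AlgebraicClosure F)))
      (hom (isLTRing_LTCoeff hπ) (isLTSeries_LTCoeff π) hP' 1) (constantCoeff_hom _ _ _ 1) (zPt (U n) (hU n))
  let μ : ℕ → AlgebraicClosure F := fun n =>
    (((μpt n : (maxNilIdeal F (E ⊔ ltField π n : IntermediateField F (AlgebraicClosure F))).toIdeal) :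
      unitBall (E ⊔ ltField π n : IntermediateField F (AlgebraicClosure F))) : (E ⊔ ltField π n : IntermediateField F _))
  -- (OR): order exactly `p^{n+1}` ⇒ `φ_{n+1}(μ_n) = 0`
  have hdiv : ∀ n, Polynomial.aeval (μ n) ((ltPolyDiv F π n).map (algebraMap 𝒪[F] F)) = 0 := fun n =>
    aeval_ltPolyDiv_coe_hom_one_zPt_eq_zero_of_addOrderOf e hq hπ he hA hP hV hp hϖ
      (E ⊔ ltField π n : IntermediateField F (AlgebraicClosure F)) (hU n) (hord n)
  -- coherence: `[π]_f μ_{n+1} = ι μ_n` (intertwining + the hypothesis + naturality), hence `f(μ_{n+1}) = μ_n`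
  have hcoh' : ∀ n, Polynomial.aeval (μ (n + 1)) ((ltPoly F π).map (algebraMap 𝒪[F] F)) = μ n := fun n => by
    refine aeval_ltPoly_coe_eq_of_ltSMul_eq hπ (sup_le_sup_left (ltField_mono hπ (Nat.le_succ n)) E) ?_
    have step1 : ltSMul (maxNilIdeal F (E ⊔ ltField π (n + 1) : IntermediateField F (AlgebraicClosure F))) (isLTRing_LTCoeff hπ)
        (isLTSeries_LTCoeff π) (LTCoeff.of F π) (μpt (n + 1)) =
        evalPt₁ (maxNilIdeal F (E ⊔ ltField π (n + 1) : IntermediateField F (AlgebraicClosure F)))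
          (hom (isLTRing_LTCoeff hπ) (isLTSeries_LTCoeff π) hP' 1) (constantCoeff_hom _ _ _ 1)
          (ltSMul (maxNilIdeal F (E ⊔ ltField π (n + 1) : IntermediateField F (AlgebraicClosure F))) (isLTRing_LTCoeff hπ)
            hP' (LTCoeff.of F π) (zPt (U (n + 1)) (hU (n + 1)))) :=
      ltSMul_evalPt₁_hom_one (M := maxNilIdeal F (E ⊔ ltField π (n + 1) : IntermediateField F (AlgebraicClosure F)))
        (hA := isLTRing_LTCoeff hπ) (hf := hP') (hg := isLTSeries_LTCoeff π) (LTCoeff.of F π) (zPt (U (n + 1)) (hU (n + 1)))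
    have step2 : inclPt (sup_le_sup_left (ltField_mono hπ (Nat.le_succ n)) E) (μpt n) =
        evalPt₁ (maxNilIdeal F (E ⊔ ltField π (n + 1) : IntermediateField F (AlgebraicClosure F)))
          (hom (isLTRing_LTCoeff hπ) (isLTSeries_LTCoeff π) hP' 1) (constantCoeff_hom _ _ _ 1)
          (inclPt (sup_le_sup_left (ltField_mono hπ (Nat.le_succ n)) E) (zPt (U n) (hU n))) :=
      Subtype.ext (algHom_evalPt₁_hom (M := maxNilIdeal F (E ⊔ ltField π n : IntermediateField F (AlgebraicClosure F)))
        (M' := maxNilIdeal F (E ⊔ ltField π (n + 1) : IntermediateField F (AlgebraicClosure F)))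
        (hA := isLTRing_LTCoeff hπ) (hf := isLTSeries_LTCoeff π) (hg := hP')
        (inclUnitBall (F := F) (sup_le_sup_left (ltField_mono hπ (Nat.le_succ n)) E)) (continuous_inclUnitBall _) 1
        (zPt (U n) (hU n)) (inclPt (sup_le_sup_left (ltField_mono hπ (Nat.le_succ n)) E) (zPt (U n) (hU n))) rfl)
    rw [step1, hcoh n, step2]
  -- (TG): the unit
  obtain ⟨a, ha⟩ := exists_unit_forall_coe_ltAct_cohPt_eq hπ hdiv hcoh'
  refine ⟨a, fun n => ?_⟩
  -- `[a]_f (ι ω_{n+1}) = μpt n` as points of `𝔪_{M_n}`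
  have h1 : evalPt₁ (maxNilIdeal F (E ⊔ ltField π n : IntermediateField F (AlgebraicClosure F)))
      (hom (isLTRing_LTCoeff hπ) (isLTSeries_LTCoeff π) (isLTSeries_LTCoeff π) (LTCoeff.of F (a : 𝒪[F])))
      (constantCoeff_hom _ _ _ _) (inclPt (le_sup_right : ltField π n ≤ E ⊔ ltField π n) (cohPt hπ n)) = μpt n := by
    apply pt_ext
    have e1 := inclUnitBall_ltSMul (le_sup_right : ltField π n ≤ E ⊔ ltField π n) (hA := isLTRing_LTCoeff hπ)
      (LTCoeff.of F (a : 𝒪[F])) (cohPt hπ n)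
    change ((((ltSMul (maxNilIdeal F (E ⊔ ltField π n : IntermediateField F (AlgebraicClosure F))) (isLTRing_LTCoeff hπ)
        (isLTSeries_LTCoeff π) (LTCoeff.of F (a : 𝒪[F])) (inclPt (le_sup_right : ltField π n ≤ E ⊔ ltField π n) (cohPt hπ n)) :
        (maxNilIdeal F (E ⊔ ltField π n : IntermediateField F (AlgebraicClosure F))).toIdeal) :
        unitBall (E ⊔ ltField π n : IntermediateField F (AlgebraicClosure F))) :
        (E ⊔ ltField π n : IntermediateField F (AlgebraicClosure F))) : AlgebraicClosure F) = μ n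
    rw [← e1]
    exact ha n
  -- `h([a]_f ι ω_{n+1}) = h([1]_{f,P′} z(U_n)) = z(U_n)` and `P(z(U_n)) = U_n`
  rw [h1]
  have h2 : evalPt₁ (maxNilIdeal F (E ⊔ ltField π n : IntermediateField F (AlgebraicClosure F)))
      (hom (isLTRing_LTCoeff hπ) hP' (isLTSeries_LTCoeff π) 1) (constantCoeff_hom _ _ _ 1) (μpt n) = zPt (U n) (hU n) :=
    evalPt₁_hom_one_evalPt₁_hom_one (M := maxNilIdeal F (E ⊔ ltField π n : IntermediateField F (AlgebraicClosure F)))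
      (hA := isLTRing_LTCoeff hπ) (hf := hP') (hg := isLTSeries_LTCoeff π) (zPt (U n) (hU n))
  rw [h2]
  exact (eq_ptOfZ_zPt (hU n)).symm

end TateUnit

end Literature.NumberTheory.EllipticCurves

end
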